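/-
Copyright (c) 2026 the pub-hodgecm-mathlib formalisation cell (harness21).  Prover seat hodgecm-mathlib-A-p06 (g28) — (U) road, U2 HEAD «μ^TF = ⊗_w μ^TF_w» (CM), 2026-09-01.
-/
import Literature.NumberTheory.Weil1964.UnitaryArchTopFormHaarProductPlaces   -- ★ FILE F (A-p06 g28): `map_archPiEquiv_archTopFormHaar_of`
import Literature.NumberTheory.Weil1964.UnitaryArchSkewPlacesLebesgue        -- ★ FILE E (A-p12 g20): (E1) (E2) (E3)
import Literature.NumberTheory.Weil1964.UnitaryArchLocalTopFormHaarCM         -- ★ FILE C (A-p06 g28): `archLocalTopFormHaar`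
import HarnessLib

/-!
# `μ^TF ↦ ⊗_w μ^TF_w` for a CM unitary group — the (U)-road product theorem U2, unconditional ((U) road, U2 HEAD)

Topic `NumberTheory/Weil1964`, namespace `Literature.NumberTheory.Weil1964.UnitaryArchTopForm`.  THEOREMS ONLY (no definition, no instance, no notation, no named fact,
no `sorry`).  Cell `pub/hodgecm-mathlib`, crux H413 = `stmt-HodgeConjecture-24833` (supports only); (U) road U2 (LEAD T9-34 (2) ∕ T9-36; owner A-p19 (g24); consumer
F0P3-p03 (g11) U5 `exists_universalPinRatio_of_localData`, binders `hfac2` ∕ `hfac1`).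

The hypotheses of ★ FILE F's `map_archPiEquiv_archTopFormHaar_of` are discharged: `hnd` by ★ `lieGramDet_ne_zero` (CM non-degeneracy of the trace form), `hndw` ∕ `hlam` ∕
`hweight` by ★ FILE E's (E3) `lieGramDetC_ne_zero_of_lieGramDet_ne_zero`, (E1) `map_lieStdLebesgue_eq_pi`, (E2) `cayleyWeight_eq_prod` at `e := skewPiEquiv` (★ FILE D,
with `traceForm_eq_sum_traceFormC`, `skewPiEquiv_skewMulL`).  The CM reading `map_archPiEquivCM_archTopFormHaar` is the statement the (U) road consumes:
`(archPiEquivCM N L H)_* μ^TF = ⊗_w archLocalTopFormHaar L N H w` for `c`-hermitian `H` with `det H` a unit.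
HONEST LABEL: HC_CM is proved only modulo the 2 remaining named inputs (hLiu418 24832, h413 24833) until rung 0 closes; nothing printed is discharged here.

## References
* J. D. Rogawski, *Automorphic Representations of Unitary Groups in Three Variables*, Ann. of Math. Stud. 123 (1990), §1.7 p. 6 («`dg = Π_v dg_v`, `dg_v = |Ω|_v`»). [Rogawski1990]
* S. Helgason, *Groups and Geometric Analysis* (2000), Ch. I §1 Thm. 1.14 p. 96. [Helgason2000]
-/

set_option autoImplicit false
-- submodule-normed vs subtype topologies on `↥(skewC …)` ∕ `↥(archSkew …)` (as in ★ FILE B ∕ ★ `UnitaryArchTopFormHaar`)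
set_option backward.isDefEq.respectTransparency false

noncomputable section

open Set MeasureTheory MeasureTheory.Measure NumberField NumberField.InfinitePlace NumberField.mixedEmbedding
open scoped Classical Matrix Matrix.Norms.Operator MatrixGroups ENNReal NNReal

namespace Literature.NumberTheory.Weil1964

namespace UnitaryArchTopForm

open Literature.NumberTheory.Automorphic Literature.NumberTheory.Automorphic.UnitaryGroup Literature.NumberTheory.Weil1964.UnitaryArchLocalTopForm

section Generic

variable (F E : Type) [Field F] [Field E] [NumberField E] [Algebra F E] (c : E ≃ₐ[F] E) (N : ℕ) (J : Matrix (Fin N) (Fin N) E)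

variable {F E c N J}

variable [MeasurableSpace (archSkew F E c N J)] [BorelSpace (archSkew F E c N J)] [MeasurableSpace (arch F E c N J)] [BorelSpace (arch F E c N J)]
  [MeasurableSpace (GL (Fin N) ℂ)] [BorelSpace (GL (Fin N) ℂ)]

/-- **THE PRODUCT THEOREM** `(archPiEquiv)_* μ^TF = ⊗_w μ^TF_w` for a `c`-hermitian `J` with `det J` a unit, `c ≠ 1` fixing every infinite place (the hypotheses of ★
`map_archPiEquiv_archTopFormHaar_of` discharged by ★ `lieGramDet_ne_zero` and ★ FILE E at `skewPiEquiv`). [cite: Rogawski1990, §1.7 p. 6] [cite: Helgason2000, Ch. I §1 Thm. 1.14 p. 96] -/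
theorem map_archPiEquiv_archTopFormHaar (hc : c ≠ 1) (hfix : ∀ w : InfinitePlace E, c • w = w) (hherm : (J.map c)ᵀ = J) (hJ : IsUnit J.det) :
    (archTopFormHaar F E c N J).map (archPiEquiv F E c N J hc hfix) =
      Measure.pi fun w : {w : InfinitePlace E // IsComplex w} => localTopFormHaar N (J.map w.1.embedding) := by
  letI : ∀ w : {w : InfinitePlace E // IsComplex w}, MeasurableSpace ↥(skewC N (J.map w.1.embedding)) := fun w => borel _
  haveI : ∀ w : {w : InfinitePlace E // IsComplex w}, BorelSpace ↥(skewC N (J.map w.1.embedding)) := fun w => ⟨rfl⟩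
  have hnd : lieGramDet F E c N J ≠ 0 := lieGramDet_ne_zero J hc hfix hherm hJ
  have htr := traceForm_eq_sum_traceFormC (J := J) hc hfix
  exact map_archPiEquiv_archTopFormHaar_of hc hfix hnd
    (fun w => lieGramDetC_ne_zero_of_lieGramDet_ne_zero (skewPiEquiv F E c N J hc hfix) htr hnd w)
    (map_lieStdLebesgue_eq_pi (skewPiEquiv F E c N J hc hfix) htr)
    (cayleyWeight_eq_prod (skewPiEquiv F E c N J hc hfix) fun X Y w => skewPiEquiv_skewMulL hc hfix X Y w)

end Generic

/-! ## The CM reading -/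

section CM

variable (L : Type) [Field L] [NumberField L] [IsCMField L] (N : ℕ) (H : Matrix (Fin N) (Fin N) L)
  [MeasurableSpace (archSkew (↥(maximalRealSubfield L)) L (IsCMField.complexConj L) N H)]
  [BorelSpace (archSkew (↥(maximalRealSubfield L)) L (IsCMField.complexConj L) N H)]
  [MeasurableSpace (arch (↥(maximalRealSubfield L)) L (IsCMField.complexConj L) N H)]
  [BorelSpace (arch (↥(maximalRealSubfield L)) L (IsCMField.complexConj L) N H)]
  [MeasurableSpace (GL (Fin N) ℂ)] [BorelSpace (GL (Fin N) ℂ)]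

/-- **U2, CM reading: `(archPiEquivCM N L H)_* μ^TF = ⊗_w μ^TF_w`** — the top-form Haar measure of `U(H)(L ⊗ ℝ)` is carried by ★ `archPiEquivCM` to the product of the
per-place top-form Haar measures ★ `archLocalTopFormHaar L N H w` on the factors `U(σ_w H)(ℂ)`, for `c`-hermitian `H` with `det H` a unit (the shape of the (U)-road
binders `hfac2` ∕ `hfac1` of ★ `exists_universalPinRatio_of_localData`). [cite: Rogawski1990, §1.7 p. 6] [cite: Helgason2000, Ch. I §1 Thm. 1.14 p. 96] -/
theorem map_archPiEquivCM_archTopFormHaar (hherm : (H.map (IsCMField.complexConj L))ᵀ = H) (hdet : IsUnit H.det) :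
    (archTopFormHaar (↥(maximalRealSubfield L)) L (IsCMField.complexConj L) N H).map (archPiEquivCM N L H) =
      Measure.pi fun w : {w : InfinitePlace L // IsComplex w} => archLocalTopFormHaar L N H w :=
  map_archPiEquiv_archTopFormHaar (IsCMField.complexConj_ne_one L) (complexConj_smul_infinitePlace L) hherm hdet

end CM

end UnitaryArchTopForm

end Literature.NumberTheory.Weil1964

end
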